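import Summits.Ventures.PercRepro.C025ProfileHallParallel
import Summits.Ventures.PercRepro.ProfileTopLevel

/-!
# C-033 «SHADOW HALL (H⁺)» — the TOP LEVEL `u = ρ(E)` for every `q` and every family (night-3 g7)

`hallIneq_top (hR : M.eRank = R) (q) : Profile.HallIneq M q R`: at the top level the price of a rank-`q` set `B` is `1`
if `E ∖ B` spans and `0` otherwise (p10's `Profile.price_top`), so the Hall inequality asks for an INJECTION from the
co-independent members of a family into the spanning sets containing a member. The injection comes from a
structural fact about the dual matroid `M✶` (whose independent sets are the co-independent sets of `M`):

**`exists_disjoint_injOn_indepFinsets`**: every finite matroid `N` has an injective map `φ` on its independent sets with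
`φ B` independent and DISJOINT from `B`. Induction on `|E|`: if every element is a loop, the only independent set is
`∅ ↦ ∅`; otherwise pick a non-loop `e`, take `φ₀` for `N ＼ e` and `φ₂` for `N ／ e`, and put
`φ B := φ₂ (B ∖ e)` for `e ∈ B` (independent sets of `N ／ e` are independent in `N`, avoid `e`, and are disjoint from
`B ∖ e`), and for `e ∉ B`: `φ B := insert e (φ₀ B)` if `φ₀ B` is independent in `N ／ e` (then `insert e (φ₀ B)` is
independent in `N`), else `φ B := φ₀ B`. Injectivity: the three kinds of images are told apart by `e ∈ φ B` and by
membership of `φ B` in the independent sets of `N ／ e`.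
With `φ` for `N = M✶`: `B ↦ E ∖ φ B` sends a co-independent member to a spanning superset, injectively.
-/

open scoped Matroid

namespace PercRepro

open Set Finset ThmH

section IndepInjection

variable {α : Type} [DecidableEq α]

open scoped Classical in
/-- The independent subsets of the ground set, as finsets. -/
noncomputable def indepFinsets (N : Matroid α) [N.Finite] : Finset (Finset α) :=
  (gr N).powerset.filter (fun B => N.Indep (B : Set α))

omit [DecidableEq α] in
/-- Membership in `indepFinsets`. -/
theorem mem_indepFinsets {N : Matroid α} [N.Finite] {B : Finset α} :
    B ∈ indepFinsets N ↔ B ⊆ gr N ∧ N.Indep (B : Set α) := by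
  unfold indepFinsets
  simp only [Finset.mem_filter, Finset.mem_powerset]

omit [DecidableEq α] in
/-- The ground finset of the dual. -/
theorem gr_dual (M : Matroid α) [M.Finite] : gr (M✶) = gr M := by
  apply Finset.coe_injective
  rw [coe_gr, coe_gr, Matroid.dual_ground]

/-- An independent set of `N ＼ {e}` is an independent set of `N` avoiding `e`. -/
theorem mem_indepFinsets_of_mem_delete {N : Matroid α} [N.Finite] {e : α} {T : Finset α}
    (hT : T ∈ indepFinsets (N ＼ ({e} : Set α))) : T ∈ indepFinsets N ∧ e ∉ T := by
  rw [mem_indepFinsets, gr_delete_singleton'', Matroid.delete_indep_iff] at hT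
  refine ⟨?_, fun h => (Finset.mem_erase.1 (hT.1 h)).1 rfl⟩
  rw [mem_indepFinsets]
  exact ⟨hT.1.trans (Finset.erase_subset _ _), hT.2.1⟩

/-- An independent set of `N` avoiding `e` is an independent set of `N ＼ {e}`. -/
theorem mem_indepFinsets_delete_of_notMem {N : Matroid α} [N.Finite] {e : α} {B : Finset α}
    (hB : B ∈ indepFinsets N) (heB : e ∉ B) : B ∈ indepFinsets (N ＼ ({e} : Set α)) := by
  rw [mem_indepFinsets] at hB
  rw [mem_indepFinsets, gr_delete_singleton'', Matroid.delete_indep_iff]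
  refine ⟨fun x hx => Finset.mem_erase.2 ⟨fun h => heB (h ▸ hx), hB.1 hx⟩, hB.2, ?_⟩
  rw [Set.disjoint_singleton_right]
  exact_mod_cast heB

/-- An independent set `T` of `N ／ {e}` (`e` a non-loop) is independent in `N`, avoids `e`, and `insert e T` is
independent in `N`. -/
theorem mem_indepFinsets_of_mem_contract {N : Matroid α} [N.Finite] {e : α} (he : N.Indep {e}) {T : Finset α}
    (hT : T ∈ indepFinsets (N ／ ({e} : Set α))) :
    T ∈ indepFinsets N ∧ e ∉ T ∧ insert e T ∈ indepFinsets N := by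
  rw [mem_indepFinsets, gr_contract_singleton, he.contract_indep_iff] at hT
  have heE : e ∈ gr N := by rw [← Finset.mem_coe, coe_gr]; exact he.subset_ground (Set.mem_singleton e)
  have heT : e ∉ T := fun h => (Finset.mem_erase.1 (hT.1 h)).1 rfl
  have hTg : T ⊆ gr N := hT.1.trans (Finset.erase_subset _ _)
  refine ⟨?_, heT, ?_⟩
  · rw [mem_indepFinsets]
    exact ⟨hTg, hT.2.2.subset Set.subset_union_left⟩
  · rw [mem_indepFinsets]
    refine ⟨Finset.insert_subset heE hTg, ?_⟩
    rw [Finset.coe_insert, Set.insert_eq, Set.union_comm]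
    exact hT.2.2

/-- For an independent set `B ∋ e` of `N` (`e` a non-loop), `B.erase e` is independent in `N ／ {e}`. -/
theorem erase_mem_indepFinsets_contract {N : Matroid α} [N.Finite] {e : α} (he : N.Indep {e}) {B : Finset α}
    (hB : B ∈ indepFinsets N) (heB : e ∈ B) : B.erase e ∈ indepFinsets (N ／ ({e} : Set α)) := by
  rw [mem_indepFinsets] at hB
  rw [mem_indepFinsets, gr_contract_singleton, he.contract_indep_iff]
  refine ⟨fun x hx => ?_, ?_, ?_⟩
  · rw [Finset.mem_erase] at hx ⊢; exact ⟨hx.1, hB.1 hx.2⟩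
  · rw [Set.disjoint_singleton_right, Finset.mem_coe]
    exact Finset.notMem_erase e B
  · have h : ((B.erase e : Finset α) : Set α) ∪ {e} = (B : Set α) := by
      rw [Set.union_comm, ← Set.insert_eq, ← Finset.coe_insert, Finset.insert_erase heB]
    rw [h]
    exact hB.2

/-- **The disjoint injection on the independent sets of a finite matroid**: there is `φ` with `φ B` independent,
disjoint from `B`, for every independent `B`, and `φ` injective on the independent sets. -/
theorem exists_disjoint_injOn_indepFinsets (N : Matroid α) [N.Finite] :
    ∃ φ : Finset α → Finset α, (∀ B ∈ indepFinsets N, φ B ∈ indepFinsets N ∧ Disjoint B (φ B)) ∧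
      Set.InjOn φ (indepFinsets N : Set (Finset α)) := by
  classical
  suffices h : ∀ n : ℕ, ∀ (N : Matroid α) [N.Finite], (gr N).card = n →
      ∃ φ : Finset α → Finset α, (∀ B ∈ indepFinsets N, φ B ∈ indepFinsets N ∧ Disjoint B (φ B)) ∧
        Set.InjOn φ (indepFinsets N : Set (Finset α)) from h _ N rfl
  intro n
  induction n using Nat.strong_induction_on with
  | _ n ih =>
  intro N _ hN
  by_cases hnl : ∃ e, N.Indep {e}
  · obtain ⟨e, he⟩ := hnl
    have heE : e ∈ gr N := by rw [← Finset.mem_coe, coe_gr]; exact he.subset_ground (Set.mem_singleton e)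
    have hlt : ((gr N).erase e).card < n := by rw [← hN]; exact Finset.card_erase_lt_of_mem heE
    obtain ⟨φ₀, hφ₀, hφ₀inj⟩ := ih _ hlt (N ＼ ({e} : Set α)) (by rw [gr_delete_singleton''])
    obtain ⟨φ₂, hφ₂, hφ₂inj⟩ := ih _ hlt (N ／ ({e} : Set α)) (by rw [gr_contract_singleton])
    set I₂ := indepFinsets (N ／ ({e} : Set α)) with hI₂
    refine ⟨fun B => if e ∈ B then φ₂ (B.erase e) else (if φ₀ B ∈ I₂ then insert e (φ₀ B) else φ₀ B), ?_, ?_⟩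
    · intro B hB
      by_cases heB : e ∈ B
      · simp only [if_pos heB]
        have h1 := erase_mem_indepFinsets_contract he hB heB
        obtain ⟨h2, h3⟩ := hφ₂ _ h1
        obtain ⟨h4, h5, _⟩ := mem_indepFinsets_of_mem_contract he h2
        refine ⟨h4, ?_⟩
        rw [Finset.disjoint_left]
        intro x hxB hxφ
        by_cases hxe : x = e
        · subst hxe; exact h5 hxφ
        · exact Finset.disjoint_left.1 h3 (Finset.mem_erase.2 ⟨hxe, hxB⟩) hxφ
      · simp only [if_neg heB]
        have h1 := mem_indepFinsets_delete_of_notMem hB heB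
        obtain ⟨h2, h3⟩ := hφ₀ _ h1
        obtain ⟨h4, h5⟩ := mem_indepFinsets_of_mem_delete h2
        by_cases hc : φ₀ B ∈ I₂
        · rw [if_pos hc]
          obtain ⟨_, _, h6⟩ := mem_indepFinsets_of_mem_contract he hc
          refine ⟨h6, ?_⟩
          rw [Finset.disjoint_left]
          intro x hxB hx
          rw [Finset.mem_insert] at hx
          rcases hx with rfl | hx
          · exact heB hxB
          · exact Finset.disjoint_left.1 h3 hxB hx
        · rw [if_neg hc]
          exact ⟨h4, h3⟩
    · intro B hB B' hB' hBB'
      rw [Finset.mem_coe] at hB hB'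
      simp only at hBB'
      by_cases heB : e ∈ B <;> by_cases heB' : e ∈ B'
      · -- both contain e
        rw [if_pos heB, if_pos heB'] at hBB'
        have h := hφ₂inj (by rw [Finset.mem_coe]; exact erase_mem_indepFinsets_contract he hB heB)
          (by rw [Finset.mem_coe]; exact erase_mem_indepFinsets_contract he hB' heB') hBB'
        rw [← Finset.insert_erase heB, ← Finset.insert_erase heB', h]
      · -- e ∈ B, e ∉ B'
        exfalso
        rw [if_pos heB, if_neg heB'] at hBB'
        have h1 := erase_mem_indepFinsets_contract he hB heB
        have h2 := (hφ₂ _ h1).1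
        have h3 := (mem_indepFinsets_of_mem_contract he h2).2.1
        by_cases hc : φ₀ B' ∈ I₂
        · rw [if_pos hc] at hBB'
          apply h3; rw [hBB']; exact Finset.mem_insert_self _ _
        · rw [if_neg hc] at hBB'
          exact hc (hBB' ▸ h2)
      · -- e ∉ B, e ∈ B'
        exfalso
        rw [if_neg heB, if_pos heB'] at hBB'
        have h1 := erase_mem_indepFinsets_contract he hB' heB'
        have h2 := (hφ₂ _ h1).1
        have h3 := (mem_indepFinsets_of_mem_contract he h2).2.1
        by_cases hc : φ₀ B ∈ I₂
        · rw [if_pos hc] at hBB'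
          apply h3; rw [← hBB']; exact Finset.mem_insert_self _ _
        · rw [if_neg hc] at hBB'
          exact hc (hBB'.symm ▸ h2)
      · -- neither contains e
        rw [if_neg heB, if_neg heB'] at hBB'
        have h1 := mem_indepFinsets_delete_of_notMem hB heB
        have h1' := mem_indepFinsets_delete_of_notMem hB' heB'
        have hne : e ∉ φ₀ B := (mem_indepFinsets_of_mem_delete (hφ₀ _ h1).1).2
        have hne' : e ∉ φ₀ B' := (mem_indepFinsets_of_mem_delete (hφ₀ _ h1').1).2
        have hφeq : φ₀ B = φ₀ B' := by
          by_cases hc : φ₀ B ∈ I₂ <;> by_cases hc' : φ₀ B' ∈ I₂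
          · rw [if_pos hc, if_pos hc'] at hBB'
            rw [← Finset.erase_insert hne, ← Finset.erase_insert hne', hBB']
          · rw [if_pos hc, if_neg hc'] at hBB'
            exact absurd (hBB' ▸ Finset.mem_insert_self e (φ₀ B)) hne'
          · rw [if_neg hc, if_pos hc'] at hBB'
            exact absurd (hBB'.symm ▸ Finset.mem_insert_self e (φ₀ B')) hne
          · rw [if_neg hc, if_neg hc'] at hBB'
            exact hBB'
        exact hφ₀inj (by rw [Finset.mem_coe]; exact h1) (by rw [Finset.mem_coe]; exact h1') hφeq
  · -- every element is a loop: the only independent set is ∅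
    push Not at hnl
    refine ⟨id, ?_, ?_⟩
    · intro B hB
      have hB' := hB
      rw [mem_indepFinsets] at hB'
      have hBe : B = ∅ := by
        by_contra hne
        obtain ⟨x, hx⟩ := Finset.nonempty_iff_ne_empty.2 hne
        exact hnl x (hB'.2.subset (Set.singleton_subset_iff.2 (by exact_mod_cast hx)))
      subst hBe
      exact ⟨hB, Finset.disjoint_empty_left _⟩
    · exact Set.injOn_id _

end IndepInjection

section HallTop

variable {α : Type} [DecidableEq α] {M : Matroid α} [M.Finite]

/-- **`(H⁺_{q,R})` at the top level `R = ρ(E)` for every `q` and every family**: the co-independent members inject into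
the spanning sets above the family (`B ↦ E ∖ φ B` with the disjoint injection `φ` of the dual matroid). -/
theorem hallIneq_top {R : ℕ} (hR : M.eRank = (R : ℕ∞)) (q : ℕ) : Profile.HallIneq M q R := by
  classical
  intro 𝒜 h𝒜
  set 𝒜' := 𝒜.filter (fun B => (R : ℕ∞) ≤ M.eRk ((gr M \ B : Finset α) : Set α)) with h𝒜'
  -- the prices: 1 on 𝒜', 0 elsewhere
  have hsum : ∑ B ∈ 𝒜, Profile.price M q R B = (𝒜'.card : ℚ) := by
    rw [← Finset.sum_filter_add_sum_filter_not 𝒜 (fun B => (R : ℕ∞) ≤ M.eRk ((gr M \ B : Finset α) : Set α))]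
    have h1 : ∑ B ∈ 𝒜', Profile.price M q R B = ∑ _B ∈ 𝒜', (1 : ℚ) :=
      Finset.sum_congr rfl (fun B hB => Profile.price_top hR q (Finset.mem_filter.1 hB).2)
    have h2 : ∑ B ∈ 𝒜.filter (fun B => ¬ (R : ℕ∞) ≤ M.eRk ((gr M \ B : Finset α) : Set α)),
        Profile.price M q R B = 0 := by
      apply Finset.sum_eq_zero
      intro B hB
      unfold Profile.price
      rw [if_neg (Finset.mem_filter.1 hB).2]
    rw [h1, h2, Finset.sum_const, nsmul_eq_mul, mul_one, add_zero]
  rw [hsum]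
  -- the disjoint injection of the dual
  obtain ⟨φ, hφ, hφinj⟩ := exists_disjoint_injOn_indepFinsets (M✶)
  have hgr : gr (M✶) = gr M := gr_dual M
  -- co-independent members are independent in the dual
  have hmem : ∀ B ∈ 𝒜', B ∈ indepFinsets (M✶) := by
    intro B hB
    rw [h𝒜', Finset.mem_filter] at hB
    have hBR := h𝒜 hB.1
    rw [Profile.mem_Rq] at hBR
    have hBE : (B : Set α) ⊆ M.E := by rw [← coe_gr]; exact_mod_cast hBR.1
    rw [mem_indepFinsets, hgr]
    refine ⟨hBR.1, ?_⟩
    rw [← Matroid.coindep_def, Matroid.coindep_iff_compl_spanning hBE, Matroid.spanning_iff_eRk_le' ]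
    refine ⟨?_, Set.sdiff_subset⟩
    rw [hR]
    have : ((gr M \ B : Finset α) : Set α) = M.E \ (B : Set α) := by rw [Finset.coe_sdiff, coe_gr]
    rw [← this]
    exact hB.2
  -- the injection B ↦ gr M ∖ φ B into the shadow
  have hmap : ∀ B ∈ 𝒜', gr M \ φ B ∈ Shadow.shadowLevel M R 𝒜 := by
    intro B hB
    have hBI := hmem B hB
    obtain ⟨hφB, hdisj⟩ := hφ B hBI
    rw [mem_indepFinsets, hgr] at hφB
    rw [mem_shadowLevel, Profile.mem_levelSet]
    refine ⟨⟨Finset.sdiff_subset, ?_⟩, B, (Finset.mem_filter.1 hB).1, ?_⟩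
    · -- gr M ∖ φ B spans: φ B is coindependent
      have hco : M.Coindep (φ B : Set α) := by rw [Matroid.coindep_def]; exact hφB.2
      have hsp : M.Spanning (M.E \ (φ B : Set α)) := hco.compl_spanning
      have : ((gr M \ φ B : Finset α) : Set α) = M.E \ (φ B : Set α) := by rw [Finset.coe_sdiff, coe_gr]
      rw [this, hsp.eRk_eq, hR]
    · intro x hx
      rw [Finset.mem_sdiff]
      exact ⟨(Finset.mem_filter.1 (h𝒜 (Finset.mem_filter.1 hB).1) |> fun h => (Profile.mem_Rq.1 (h𝒜 (Finset.mem_filter.1 hB).1)).1) hx,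
        fun h => Finset.disjoint_left.1 hdisj hx h⟩
  have hinj : Set.InjOn (fun B => gr M \ φ B) (𝒜' : Set (Finset α)) := by
    intro B hB B' hB' h
    rw [Finset.mem_coe] at hB hB'
    simp only at h
    have hφB := (hφ B (hmem B hB)).1
    have hφB' := (hφ B' (hmem B' hB')).1
    rw [mem_indepFinsets, hgr] at hφB hφB'
    have hφeq : φ B = φ B' := by
      rw [← Finset.sdiff_sdiff_eq_self hφB.1, ← Finset.sdiff_sdiff_eq_self hφB'.1, h]
    exact hφinj (by rw [Finset.mem_coe]; exact hmem B hB) (by rw [Finset.mem_coe]; exact hmem B' hB') hφeq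
  exact_mod_cast Finset.card_le_card_of_injOn _ hmap hinj

end HallTop

end PercRepro
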